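import Mathlib.LinearAlgebra.Matrix.Reindex
import Literature.NumberTheory.Automorphic.RootData
import HarnessLib

/-!
# Reindexing `GL m k ≃ GL m' k` preserves the vocabulary of linear algebraic groups

Trunk T-AUTOMORPHIC (G25 AutomorphicL). The concrete vocabulary of `LinearAlgebraicGroups.lean`
and `RootData.lean` (`IsAlgebraicSubgroup`, `IsZConnected`, `IsTorusSubgroup`,
`IsConnectedReductive`, `IsMaximalTorusIn`, character and cocharacter lattices, `charPairingInt`,
`IsRootHom`, `roots`, `IsAlgebraicSL2Hom`, `IsRootDatumOf`) is attached to subgroups of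
`GL m k` for a *fixed* index type `m`. The statements of the Langlands prelude
(`Literature.NumberTheory.Automorphic.chevalley_existence` etc.) quantify over `GL (Fin N) k`,
while constructions naturally produce other index types (e.g. `Σ j, mb j` for a direct sum of
blocks). This file transports the whole vocabulary along the group isomorphism
`reindexGL e : GL m k ≃* GL m' k` induced by a bijection `e : m ≃ m'` (Mathlib
`Matrix.reindexAlgEquiv`): coordinates are permuted (`glCoordFun_reindexGL`), so polynomial
conditions are transported by renaming variables (`MvPolynomial.rename`), and everything else
is functorial in the group isomorphism. Main results: `isConnectedReductive_map_reindexGL`,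
`isMaximalTorusIn_map_reindexGL`, `IsRootDatumOf.map_reindexGL` and the packaged
`exists_fin_of_isRootDatumOf` (**a realisation of a root datum in `GL m k` gives one in
`GL (Fin (card m)) k`**). Everything is proved; all statements are [folklore] bookkeeping.

## Mathlib

`Matrix.reindexAlgEquiv`, `Matrix.det_reindex_self`, `Units.mapEquiv`, `MulEquiv.subgroupMap`,
`MvPolynomial.rename`, `MvPolynomial.eval_rename`, `LinearEquiv.isSemisimple_iff` with
`Matrix.toLin'_reindex`, `Subgroup.relIndex_map_map_of_injective`, and the instance
`Subgroup.map_isMulCommutative` (commutativity of `e · T`). Mathlib has no reindexing of `GL`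
(only `Matrix.GeneralLinearGroup.map` along ring homomorphisms); the transport statements here
are new, the group theory they rest on is Mathlib's.
-/

noncomputable section

open scoped MatrixGroups

namespace Literature.NumberTheory.Automorphic

variable {k : Type*} [Field k]
variable {m m' : Type*} [Fintype m] [DecidableEq m] [Fintype m'] [DecidableEq m']

/-! ### The reindexing isomorphism and the coordinates -/

/-- **The group isomorphism `GL m k ≃* GL m' k` induced by `e : m ≃ m'`** (conjugation by the
corresponding permutation of coordinates; Mathlib `Matrix.reindexAlgEquiv`). [folklore] -/
def reindexGL (e : m ≃ m') : GL m k ≃* GL m' k :=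
  Units.mapEquiv (Matrix.reindexAlgEquiv k k e).toMulEquiv

/-- The matrix of `reindexGL e g` is the reindexed matrix. [folklore] -/
@[simp] lemma coe_reindexGL (e : m ≃ m') (g : GL m k) :
    ((reindexGL e g : GL m' k) : Matrix m' m' k) = Matrix.reindex e e (g : Matrix m m k) := rfl

/-- `reindexGL e.symm` is the inverse of `reindexGL e`. [folklore] -/
lemma reindexGL_symm (e : m ≃ m') : (reindexGL (k := k) e).symm = reindexGL e.symm := rfl

/-- `reindexGL e.symm (reindexGL e g) = g`. [folklore] -/
@[simp] lemma reindexGL_symm_apply_apply (e : m ≃ m') (g : GL m k) :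
    reindexGL e.symm (reindexGL e g) = g := (reindexGL (k := k) e).symm_apply_apply g

/-- `reindexGL e (reindexGL e.symm g) = g`. [folklore] -/
@[simp] lemma reindexGL_apply_symm_apply (e : m ≃ m') (g : GL m' k) :
    reindexGL e (reindexGL e.symm g) = g := (reindexGL (k := k) e).apply_symm_apply g

/-- The induced map on coordinate indices `GLCoord m → GLCoord m'`. [folklore] -/
def coordMap (e : m ≃ m') : GLCoord m → GLCoord m' := Sum.map (Prod.map e e) id

/-- **Coordinates of the reindexed matrix**: `x_{e i, e j} (e · g) = x_{i j} (g)` and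
`det⁻¹ (e · g) = det⁻¹ (g)`, i.e. `glCoordFun (reindexGL e g) ∘ coordMap e = glCoordFun g`.
[folklore] -/
lemma glCoordFun_reindexGL_comp (e : m ≃ m') (g : GL m k) :
    glCoordFun (reindexGL e g) ∘ coordMap e = glCoordFun g := by
  funext c
  rcases c with ⟨i, j⟩ | ⟨⟩
  · simp [coordMap, Matrix.reindex_apply]
  · simp [coordMap]

/-- Evaluation of a renamed polynomial at the reindexed matrix. [folklore] -/
lemma eval_rename_coordMap (e : m ≃ m') (p : MvPolynomial (GLCoord m) k) (g : GL m k) :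
    MvPolynomial.eval (glCoordFun (reindexGL e g)) (MvPolynomial.rename (coordMap e) p) =
      MvPolynomial.eval (glCoordFun g) p := by
  rw [MvPolynomial.eval_rename, glCoordFun_reindexGL_comp]

/-! ### Algebraic subgroups, connectedness -/

/-- **The image of an algebraic subgroup under reindexing is algebraic** (rename the defining
polynomials). [folklore] -/
theorem IsAlgebraicSubgroup.map_reindexGL (e : m ≃ m') {H : Subgroup (GL m k)}
    (hH : IsAlgebraicSubgroup H) :
    IsAlgebraicSubgroup (H.map (reindexGL e).toMonoidHom) := by
  obtain ⟨S, hS⟩ := hH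
  refine ⟨MvPolynomial.rename (coordMap e) '' S, Set.ext fun g' => ?_⟩
  constructor
  · rintro ⟨g, hg, rfl⟩
    rintro _ ⟨p, hp, rfl⟩
    change MvPolynomial.eval (glCoordFun (reindexGL e g)) _ = 0
    rw [eval_rename_coordMap]
    have hg' : g ∈ (H : Set (GL m k)) := hg
    rw [hS] at hg'
    exact hg' p hp
  · intro hg'
    refine ⟨reindexGL e.symm g', ?_, reindexGL_apply_symm_apply e g'⟩
    change reindexGL e.symm g' ∈ (H : Set (GL m k))
    rw [hS]
    intro p hp
    have h := hg' _ ⟨p, hp, rfl⟩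
    rwa [← reindexGL_apply_symm_apply e g', eval_rename_coordMap] at h

/-- Algebraicity is invariant under reindexing. [folklore] -/
theorem isAlgebraicSubgroup_map_reindexGL_iff (e : m ≃ m') {H : Subgroup (GL m k)} :
    IsAlgebraicSubgroup (H.map (reindexGL e).toMonoidHom) ↔ IsAlgebraicSubgroup H := by
  refine ⟨fun h => ?_, fun h => h.map_reindexGL e⟩
  have h' := h.map_reindexGL e.symm
  rwa [Subgroup.map_map, show (reindexGL e.symm).toMonoidHom.comp (reindexGL (k := k) e).toMonoidHom =
    MonoidHom.id _ from MonoidHom.ext fun g => reindexGL_symm_apply_apply e g, Subgroup.map_id] at h'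

/-- `map` along `reindexGL e` and `reindexGL e.symm` are inverse on subgroups. [folklore] -/
lemma map_reindexGL_symm_map (e : m ≃ m') (H : Subgroup (GL m k)) :
    (H.map (reindexGL e).toMonoidHom).map (reindexGL e.symm).toMonoidHom = H := by
  rw [Subgroup.map_map, show (reindexGL e.symm).toMonoidHom.comp (reindexGL (k := k) e).toMonoidHom =
    MonoidHom.id _ from MonoidHom.ext fun g => reindexGL_symm_apply_apply e g, Subgroup.map_id]

/-- `map` along `reindexGL e.symm` then `reindexGL e` is the identity on subgroups. [folklore] -/
lemma map_reindexGL_map_symm (e : m ≃ m') (H' : Subgroup (GL m' k)) :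
    (H'.map (reindexGL e.symm).toMonoidHom).map (reindexGL e).toMonoidHom = H' := by
  have := map_reindexGL_symm_map e.symm H'
  rwa [Equiv.symm_symm] at this

/-- `map` along `reindexGL e` is monotone and reflects the order. [folklore] -/
lemma map_reindexGL_le_iff (e : m ≃ m') {H K : Subgroup (GL m k)} :
    H.map (reindexGL e).toMonoidHom ≤ K.map (reindexGL e).toMonoidHom ↔ H ≤ K :=
  Subgroup.map_le_map_iff_of_injective (reindexGL e).injective

/-- `map` along `reindexGL e` is injective on subgroups. [folklore] -/
lemma map_reindexGL_injective (e : m ≃ m') :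
    Function.Injective fun H : Subgroup (GL m k) => H.map (reindexGL e).toMonoidHom :=
  Subgroup.map_injective (reindexGL e).injective

/-- Pulling back a subgroup `K' ≤ H.map (reindexGL e)`: the subgroup `K = e⁻¹ K'` of `H` with
the same algebraicity and relative index. [folklore] -/
lemma pullback_reindexGL (e : m ≃ m') {H : Subgroup (GL m k)} {K' : Subgroup (GL m' k)}
    (hK'le : K' ≤ H.map (reindexGL e).toMonoidHom) :
    ∃ K : Subgroup (GL m k), K.map (reindexGL e).toMonoidHom = K' ∧ K ≤ H ∧
      (IsAlgebraicSubgroup K ↔ IsAlgebraicSubgroup K') ∧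
      (K.subgroupOf H).index = (K'.subgroupOf (H.map (reindexGL e).toMonoidHom)).index := by
  refine ⟨K'.map (reindexGL e.symm).toMonoidHom, map_reindexGL_map_symm e K', ?_, ?_, ?_⟩
  · rw [← map_reindexGL_le_iff e, map_reindexGL_map_symm]; exact hK'le
  · rw [← isAlgebraicSubgroup_map_reindexGL_iff e, map_reindexGL_map_symm]
  · change Subgroup.relIndex _ H = Subgroup.relIndex K' _
    rw [← Subgroup.relIndex_map_map_of_injective _ H (reindexGL e).injective]
    change (Subgroup.map (reindexGL e).toMonoidHom _).relIndex (H.map (reindexGL e).toMonoidHom) = _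
    rw [map_reindexGL_map_symm]

/-- **Zariski-connectedness is invariant under reindexing.** [folklore] -/
theorem IsZConnected.map_reindexGL (e : m ≃ m') {H : Subgroup (GL m k)} (hH : IsZConnected H) :
    IsZConnected (H.map (reindexGL e).toMonoidHom) := by
  refine ⟨hH.1.map_reindexGL e, fun K' hK'le hK' hfin => ?_⟩
  obtain ⟨K, hKK', hKle, hKalg, hKind⟩ := pullback_reindexGL e hK'le
  have hKfin : (K.subgroupOf H).FiniteIndex := ⟨by rw [hKind]; exact hfin.index_ne_zero⟩
  rw [← hKK', hH.2 K hKle (hKalg.2 hK') hKfin]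

/-- Zariski-connectedness iff. [folklore] -/
theorem isZConnected_map_reindexGL_iff (e : m ≃ m') {H : Subgroup (GL m k)} :
    IsZConnected (H.map (reindexGL e).toMonoidHom) ↔ IsZConnected H := by
  refine ⟨fun h => ?_, fun h => h.map_reindexGL e⟩
  have h' := h.map_reindexGL e.symm
  rwa [map_reindexGL_symm_map] at h'

/-! ### Unipotent and semisimple elements, tori, reductive groups, maximal tori -/

/-- Unipotency is invariant under reindexing. [folklore] -/
theorem isUnipotentElt_reindexGL_iff (e : m ≃ m') (g : GL m k) :
    IsUnipotentElt (reindexGL e g) ↔ IsUnipotentElt g := by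
  unfold IsUnipotentElt
  rw [coe_reindexGL, show Matrix.reindex e e (g : Matrix m m k) - 1 =
    Matrix.reindexAlgEquiv k k e ((g : Matrix m m k) - 1) by
      rw [map_sub, map_one, Matrix.coe_reindexAlgEquiv]]
  exact ⟨fun h => by simpa using h.map (Matrix.reindexAlgEquiv k k e).symm,
    fun h => h.map (Matrix.reindexAlgEquiv k k e)⟩

/-- Semisimplicity is invariant under reindexing (Mathlib `LinearEquiv.isSemisimple_iff` along
the coordinate permutation). [folklore] -/
theorem isSemisimpleElt_reindexGL_iff (e : m ≃ m') (g : GL m k) :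
    IsSemisimpleElt (reindexGL e g) ↔ IsSemisimpleElt g := by
  unfold IsSemisimpleElt
  rw [coe_reindexGL, Matrix.toLin'_reindex]
  symm
  refine LinearEquiv.isSemisimple_iff _ _ (LinearEquiv.funCongrLeft k k e.symm) ?_
  have h : ((LinearEquiv.funCongrLeft k k e : (m' → k) ≃ₗ[k] (m → k)) : (m' → k) →ₗ[k] (m → k)) ∘ₗ
      ((LinearEquiv.funCongrLeft k k e.symm : (m → k) ≃ₗ[k] (m' → k)) : (m → k) →ₗ[k] (m' → k)) =
        LinearMap.id := by
    ext v i
    simp [LinearMap.funLeft]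
  rw [LinearMap.comp_assoc, LinearMap.comp_assoc, h, LinearMap.comp_id]

/-- Unipotent subgroups are preserved by reindexing. [folklore] -/
theorem isUnipotentSubgroup_map_reindexGL_iff (e : m ≃ m') {U : Subgroup (GL m k)} :
    IsUnipotentSubgroup (U.map (reindexGL e).toMonoidHom) ↔ IsUnipotentSubgroup U := by
  constructor
  · intro h u hu
    rw [← isUnipotentElt_reindexGL_iff e]
    exact h _ ⟨u, hu, rfl⟩
  · rintro h _ ⟨u, hu, rfl⟩
    exact (isUnipotentElt_reindexGL_iff e u).2 (h u hu)

/-- Commutativity is preserved by reindexing. [folklore] -/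
theorem isMulCommutative_map_reindexGL_iff (e : m ≃ m') {T : Subgroup (GL m k)} :
    IsMulCommutative ↥(T.map (reindexGL e).toMonoidHom) ↔ IsMulCommutative ↥T := by
  constructor
  · intro h
    refine ⟨⟨fun a b => Subtype.ext ((reindexGL e).injective ?_)⟩⟩
    have := congrArg Subtype.val
      (h.1.comm ⟨reindexGL e a, ⟨a, a.2, rfl⟩⟩ ⟨reindexGL e b, ⟨b, b.2, rfl⟩⟩)
    simp only [Subgroup.coe_mul] at this
    rw [Subgroup.coe_mul, Subgroup.coe_mul, map_mul, map_mul]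
    exact this
  · intro h
    exact Subgroup.map_isMulCommutative _ _

/-- **Tori are preserved by reindexing.** [folklore] -/
theorem isTorusSubgroup_map_reindexGL_iff (e : m ≃ m') {T : Subgroup (GL m k)} :
    IsTorusSubgroup (T.map (reindexGL e).toMonoidHom) ↔ IsTorusSubgroup T := by
  unfold IsTorusSubgroup
  rw [isZConnected_map_reindexGL_iff, isMulCommutative_map_reindexGL_iff]
  refine and_congr_right fun _ => and_congr_right fun _ => ⟨fun h t ht => ?_, ?_⟩
  · rw [← isSemisimpleElt_reindexGL_iff e]
    exact h _ ⟨t, ht, rfl⟩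
  · rintro h _ ⟨t, ht, rfl⟩
    exact (isSemisimpleElt_reindexGL_iff e t).2 (h t ht)

/-- Normality of `U` in `G` is preserved by reindexing. [folklore] -/
lemma normal_subgroupOf_map_reindexGL_iff (e : m ≃ m') {U G : Subgroup (GL m k)} (hUG : U ≤ G) :
    ((U.map (reindexGL e).toMonoidHom).subgroupOf (G.map (reindexGL e).toMonoidHom)).Normal ↔
      (U.subgroupOf G).Normal := by
  rw [Subgroup.normal_subgroupOf_iff_le_normalizer hUG,
    Subgroup.normal_subgroupOf_iff_le_normalizer ((map_reindexGL_le_iff e).2 hUG),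
    ← Subgroup.map_equiv_normalizer_eq U (reindexGL e), map_reindexGL_le_iff]

/-- **Reductivity is preserved by reindexing.** [folklore] -/
theorem isReductiveSubgroup_map_reindexGL (e : m ≃ m') {G : Subgroup (GL m k)}
    (hG : IsReductiveSubgroup G) : IsReductiveSubgroup (G.map (reindexGL e).toMonoidHom) := by
  refine ⟨hG.1.map_reindexGL e, fun U' hU'le hU'n hU'c hU'u => ?_⟩
  obtain ⟨U, hUU', hUle, -, -⟩ := pullback_reindexGL e hU'le
  subst hUU'
  rw [hG.2 U hUle ((normal_subgroupOf_map_reindexGL_iff e hUle).1 hU'n)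
    ((isZConnected_map_reindexGL_iff e).1 hU'c) ((isUnipotentSubgroup_map_reindexGL_iff e).1 hU'u),
    Subgroup.map_bot]

/-- **Connected reductive groups are preserved by reindexing.** [folklore] -/
theorem isConnectedReductive_map_reindexGL (e : m ≃ m') {G : Subgroup (GL m k)}
    (hG : IsConnectedReductive G) : IsConnectedReductive (G.map (reindexGL e).toMonoidHom) :=
  ⟨hG.1.map_reindexGL e, isReductiveSubgroup_map_reindexGL e hG.2⟩

/-- **Maximal tori are preserved by reindexing.** [folklore] -/
theorem isMaximalTorusIn_map_reindexGL (e : m ≃ m') {T G : Subgroup (GL m k)}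
    (hT : IsMaximalTorusIn T G) :
    IsMaximalTorusIn (T.map (reindexGL e).toMonoidHom) (G.map (reindexGL e).toMonoidHom) := by
  refine ⟨(map_reindexGL_le_iff e).2 hT.1, (isTorusSubgroup_map_reindexGL_iff e).2 hT.2.1,
    fun S' hTS' hS'G hS' => ?_⟩
  obtain ⟨S, hSS', hSle, -, -⟩ := pullback_reindexGL e hS'G
  subst hSS'
  rw [hT.2.2 S ((map_reindexGL_le_iff e).1 hTS') hSle ((isTorusSubgroup_map_reindexGL_iff e).1 hS')]

/-! ### Characters and cocharacters -/

section Characters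

variable (e : m ≃ m') (T : Subgroup (GL m k))

/-- The isomorphism `T ≃* e · T`. [folklore] -/
abbrev subgroupReindex : ↥T ≃* ↥(T.map (reindexGL e).toMonoidHom) :=
  (reindexGL e).subgroupMap T

/-- Transport of a character `χ` of `T` to `e · T`: `χ ∘ e⁻¹`. [folklore] -/
def charReindex (χ : ↥T →* kˣ) : ↥(T.map (reindexGL e).toMonoidHom) →* kˣ :=
  χ.comp (subgroupReindex e T).symm.toMonoidHom

/-- Transport of a cocharacter `γ` of `T` to `e · T`: `e ∘ γ`. [folklore] -/
def cocharReindex (γ : kˣ →* ↥T) : kˣ →* ↥(T.map (reindexGL e).toMonoidHom) :=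
  (subgroupReindex e T).toMonoidHom.comp γ

/-- `charReindex χ (e t) = χ t`. [folklore] -/
@[simp] lemma charReindex_apply (χ : ↥T →* kˣ) (t : ↥T) :
    charReindex e T χ (subgroupReindex e T t) = χ t := by
  rw [charReindex, MonoidHom.comp_apply, MulEquiv.coe_toMonoidHom, MulEquiv.symm_apply_apply]

/-- The matrix of `cocharReindex γ c`. [folklore] -/
@[simp] lemma coe_cocharReindex_apply (γ : kˣ →* ↥T) (c : kˣ) :
    ((cocharReindex e T γ c : ↥(T.map (reindexGL e).toMonoidHom)) : GL m' k) = reindexGL e (γ c) := rfl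

/-- Algebraic characters transport to algebraic characters (rename the polynomial). [folklore] -/
theorem isAlgebraicChar_charReindex {χ : ↥T →* kˣ} (hχ : IsAlgebraicChar χ) :
    IsAlgebraicChar (charReindex e T χ) := by
  obtain ⟨p, hp⟩ := hχ
  refine ⟨MvPolynomial.rename (coordMap e) p, ?_⟩
  rintro ⟨_, ⟨t, ht, rfl⟩⟩
  have h1 : charReindex e T χ ⟨(reindexGL e).toMonoidHom t, ⟨t, ht, rfl⟩⟩ = χ ⟨t, ht⟩ :=
    charReindex_apply e T χ ⟨t, ht⟩
  rw [h1, hp ⟨t, ht⟩]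
  exact (eval_rename_coordMap e p t).symm

/-- Algebraic cocharacters transport to algebraic cocharacters. [folklore] -/
theorem isAlgebraicCochar_cocharReindex {γ : kˣ →* ↥T} (hγ : IsAlgebraicCochar γ) :
    IsAlgebraicCochar (cocharReindex e T γ) := by
  obtain ⟨P, hP⟩ := hγ
  refine ⟨fun c => P ((Equiv.sumCongr (Equiv.prodCongr e e) (Equiv.refl Unit)).symm c),
    fun a c => ?_⟩
  have h := congrFun (glCoordFun_reindexGL_comp e (γ a : GL m k))
    ((Equiv.sumCongr (Equiv.prodCongr e e) (Equiv.refl Unit)).symm c)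
  rw [coe_cocharReindex_apply, ← hP a]
  rw [Function.comp_apply] at h
  convert h using 2
  rcases c with ⟨i, j⟩ | ⟨⟩ <;> simp [coordMap]

end Characters

/-- The coordinates of `e · t` in terms of those of `t`. [folklore] -/
lemma glCoordFun_reindexGL_eq (e : m ≃ m') (g : GL m k) :
    glCoordFun (reindexGL e g) = glCoordFun g ∘ coordMap e.symm := by
  have h := glCoordFun_reindexGL_comp e.symm (reindexGL e g)
  rw [reindexGL_symm_apply_apply] at h
  exact h.symm

/-- Algebraic characters of `e · T` pull back to algebraic characters of `T`. [folklore] -/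
theorem isAlgebraicChar_comp_subgroupReindex (e : m ≃ m') (T : Subgroup (GL m k))
    {χ' : ↥(T.map (reindexGL e).toMonoidHom) →* kˣ} (hχ' : IsAlgebraicChar χ') :
    IsAlgebraicChar (χ'.comp (subgroupReindex e T).toMonoidHom) := by
  obtain ⟨p, hp⟩ := hχ'
  refine ⟨MvPolynomial.rename (coordMap e.symm) p, fun t => ?_⟩
  rw [MonoidHom.comp_apply, MulEquiv.coe_toMonoidHom, hp, MvPolynomial.eval_rename,
    ← glCoordFun_reindexGL_eq]
  rfl

/-- Algebraic cocharacters of `e · T` pull back to algebraic cocharacters of `T`. [folklore] -/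
theorem isAlgebraicCochar_symm_comp (e : m ≃ m') (T : Subgroup (GL m k))
    {γ' : kˣ →* ↥(T.map (reindexGL e).toMonoidHom)} (hγ' : IsAlgebraicCochar γ') :
    IsAlgebraicCochar ((subgroupReindex e T).symm.toMonoidHom.comp γ') := by
  obtain ⟨P, hP⟩ := hγ'
  refine ⟨fun c => P (coordMap e c), fun a c => ?_⟩
  rw [← hP a]
  have h := congrFun (glCoordFun_reindexGL_comp e
    (((subgroupReindex e T).symm.toMonoidHom.comp γ' a : ↥T) : GL m k)) c
  rw [Function.comp_apply] at h
  rw [← h]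
  congr 2
  change reindexGL e ((reindexGL e).symm (γ' a : GL m' k)) = _
  rw [MulEquiv.apply_symm_apply]

section Lattices

variable (e : m ≃ m') (T : Subgroup (GL m k))

/-- **The character lattices of `T` and `e · T` are identified** (`χ ↦ χ ∘ e⁻¹`). [folklore] -/
def charLatticeReindex :
    Additive ↥(characterLattice T) ≃+ Additive ↥(characterLattice (T.map (reindexGL e).toMonoidHom)) where
  toFun χ := Additive.ofMul ⟨charReindex e T (Additive.toMul χ).1,
    isAlgebraicChar_charReindex e T (Additive.toMul χ).2⟩
  invFun χ' := Additive.ofMul ⟨(Additive.toMul χ').1.comp (subgroupReindex e T).toMonoidHom,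
    isAlgebraicChar_comp_subgroupReindex e T (Additive.toMul χ').2⟩
  left_inv χ := by
    refine congrArg Additive.ofMul (Subtype.ext (MonoidHom.ext fun t => ?_))
    exact charReindex_apply e T _ t
  right_inv χ' := by
    refine congrArg Additive.ofMul (Subtype.ext (MonoidHom.ext fun t' => ?_))
    change ((Additive.toMul χ').1.comp _) ((subgroupReindex e T).symm t') = _
    rw [MonoidHom.comp_apply, MulEquiv.coe_toMonoidHom, MulEquiv.apply_symm_apply]
    rfl
  map_add' χ₁ χ₂ := by
    refine congrArg Additive.ofMul (Subtype.ext (MonoidHom.ext fun t' => ?_))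
    rfl

/-- Unfolding of `charLatticeReindex`. [folklore] -/
lemma coe_toMul_charLatticeReindex (χ : Additive ↥(characterLattice T)) :
    ((Additive.toMul (charLatticeReindex e T χ) : ↥(characterLattice _)) : _ →* kˣ) =
      charReindex e T (Additive.toMul χ).1 := rfl

variable [IsMulCommutative ↥T]

/-- **The cocharacter lattices of `T` and `e · T` are identified** (`γ ↦ e ∘ γ`). [folklore] -/
def cocharLatticeReindex :
    Additive ↥(cocharacterLattice T) ≃+
      Additive ↥(cocharacterLattice (T.map (reindexGL e).toMonoidHom)) where
  toFun γ := Additive.ofMul ⟨cocharReindex e T (Additive.toMul γ).1,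
    isAlgebraicCochar_cocharReindex e T (Additive.toMul γ).2⟩
  invFun γ' := Additive.ofMul ⟨(subgroupReindex e T).symm.toMonoidHom.comp (Additive.toMul γ').1,
    isAlgebraicCochar_symm_comp e T (Additive.toMul γ').2⟩
  left_inv γ := by
    refine congrArg Additive.ofMul (Subtype.ext (MonoidHom.ext fun c => ?_))
    exact (subgroupReindex e T).symm_apply_apply _
  right_inv γ' := by
    refine congrArg Additive.ofMul (Subtype.ext (MonoidHom.ext fun c => ?_))
    exact (subgroupReindex e T).apply_symm_apply _
  map_add' γ₁ γ₂ := by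
    refine congrArg Additive.ofMul (Subtype.ext (MonoidHom.ext fun c => ?_))
    exact map_mul (subgroupReindex e T) _ _

/-- Unfolding of `cocharLatticeReindex`. [folklore] -/
lemma coe_toMul_cocharLatticeReindex (γ : Additive ↥(cocharacterLattice T)) :
    ((Additive.toMul (cocharLatticeReindex e T γ) : ↥(cocharacterLattice _)) : kˣ →* _) =
      cocharReindex e T (Additive.toMul γ).1 := rfl

omit [IsMulCommutative ↥T] in
/-- The pairing only depends on the composite `χ ∘ γ`. [folklore] -/
lemma charPairingInt_congr {n₁ n₂ : Type*} [Fintype n₁] [DecidableEq n₁] [Fintype n₂] [DecidableEq n₂]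
    {T₁ : Subgroup (GL n₁ k)} {T₂ : Subgroup (GL n₂ k)} {χ₁ : ↥T₁ →* kˣ} {γ₁ : kˣ →* ↥T₁}
    {χ₂ : ↥T₂ →* kˣ} {γ₂ : kˣ →* ↥T₂} (h : χ₁.comp γ₁ = χ₂.comp γ₂) :
    charPairingInt χ₁ γ₁ = charPairingInt χ₂ γ₂ := by
  unfold charPairingInt
  generalize χ₁.comp γ₁ = f at h ⊢
  subst h
  rfl

omit [IsMulCommutative ↥T] in
/-- **The pairing is invariant**: `⟨χ ∘ e⁻¹, e ∘ γ⟩ = ⟨χ, γ⟩`. [folklore] -/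
theorem charPairingInt_reindex (χ : ↥T →* kˣ) (γ : kˣ →* ↥T) :
    charPairingInt (charReindex e T χ) (cocharReindex e T γ) = charPairingInt χ γ := by
  refine charPairingInt_congr (MonoidHom.ext fun c => ?_)
  change χ ((subgroupReindex e T).symm (subgroupReindex e T (γ c))) = χ (γ c)
  rw [MulEquiv.symm_apply_apply]

end Lattices

/-! ### Root homomorphisms, roots, `SL₂`-homomorphisms -/

section RootHoms

variable (e : m ≃ m') {G T : Subgroup (GL m k)}

/-- Algebraic additive homomorphisms transport. [folklore] -/
theorem isAlgebraicAddHom_reindex {u : Multiplicative k →* ↥G} (hu : IsAlgebraicAddHom u) :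
    IsAlgebraicAddHom ((subgroupReindex e G).toMonoidHom.comp u) := by
  obtain ⟨P, hP⟩ := hu
  refine ⟨fun c => P (coordMap e.symm c), fun x c => ?_⟩
  rw [← hP x]
  change glCoordFun (reindexGL e ((u (Multiplicative.ofAdd x) : ↥G) : GL m k)) c = _
  rw [glCoordFun_reindexGL_eq]
  rfl

/-- **Root homomorphisms transport to root homomorphisms** (for the transported character).
[folklore] -/
theorem IsRootHom.reindex (hTG : T ≤ G) {α : ↥T →* kˣ} {u : Multiplicative k →* ↥G}
    (h : IsRootHom G T hTG α u) :
    IsRootHom (G.map (reindexGL e).toMonoidHom) (T.map (reindexGL e).toMonoidHom)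
      ((map_reindexGL_le_iff e).2 hTG) (charReindex e T α)
      ((subgroupReindex e G).toMonoidHom.comp u) := by
  obtain ⟨halg, ⟨q, hq⟩, hconj⟩ := h
  refine ⟨isAlgebraicAddHom_reindex e halg, ⟨MvPolynomial.rename (coordMap e) q, fun x => ?_⟩, ?_⟩
  · have h1 := eval_rename_coordMap e q ((u (Multiplicative.ofAdd x) : ↥G) : GL m k)
    rw [hq x] at h1
    exact h1
  · rintro ⟨_, ⟨t, ht, rfl⟩⟩ x
    have h1 : charReindex e T α ⟨(reindexGL e).toMonoidHom t, ⟨t, ht, rfl⟩⟩ = α ⟨t, ht⟩ :=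
      charReindex_apply e T α ⟨t, ht⟩
    rw [h1]
    have h2 := congrArg (fun g : ↥G => reindexGL e (g : GL m k)) (hconj ⟨t, ht⟩ x)
    simp only [Subgroup.coe_mul, Subgroup.coe_inv, map_mul, map_inv, Subgroup.coe_inclusion] at h2
    apply Subtype.ext
    simp only [Subgroup.coe_mul, Subgroup.coe_inv, Subgroup.coe_inclusion, MonoidHom.comp_apply,
      MulEquiv.coe_toMonoidHom]
    exact h2

/-- **The roots of `(e · G, e · T)` are the transported roots of `(G, T)`** (one inclusion;
the other follows by symmetry). [folklore] -/
theorem charLatticeReindex_mem_roots {α : ↥(characterLattice T)} (hα : α ∈ roots G T) :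
    Additive.toMul (charLatticeReindex e T (Additive.ofMul α)) ∈
      roots (G.map (reindexGL e).toMonoidHom) (T.map (reindexGL e).toMonoidHom) := by
  obtain ⟨hne, hTG, u, hu⟩ := hα
  refine ⟨fun h1 => hne (MonoidHom.ext fun t => ?_), (map_reindexGL_le_iff e).2 hTG, _, hu.reindex e hTG⟩
  have h := DFunLike.congr_fun h1 (subgroupReindex e T t)
  rw [coe_toMul_charLatticeReindex, toMul_ofMul, charReindex_apply] at h
  exact h

/-- Root homomorphisms of `(e · G, e · T)` for a transported character pull back to root
homomorphisms of `(G, T)`. [folklore] -/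
theorem IsRootHom.of_reindex (hTG : T ≤ G) {α : ↥T →* kˣ}
    {u' : Multiplicative k →* ↥(G.map (reindexGL e).toMonoidHom)}
    (h : IsRootHom (G.map (reindexGL e).toMonoidHom) (T.map (reindexGL e).toMonoidHom)
      ((map_reindexGL_le_iff e).2 hTG) (charReindex e T α) u') :
    IsRootHom G T hTG α ((subgroupReindex e G).symm.toMonoidHom.comp u') := by
  obtain ⟨⟨Pu, hPu⟩, ⟨q, hq⟩, hconj⟩ := h
  have hcoord : ∀ x : k, glCoordFun ((((subgroupReindex e G).symm.toMonoidHom.comp u')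
      (Multiplicative.ofAdd x) : ↥G) : GL m k) =
        glCoordFun ((u' (Multiplicative.ofAdd x) : ↥(G.map _)) : GL m' k) ∘ coordMap e := by
    intro x
    rw [← glCoordFun_reindexGL_comp e]
    congr 2
    exact (reindexGL (k := k) e).apply_symm_apply _
  refine ⟨⟨fun c => Pu (coordMap e c), fun x c => ?_⟩, ⟨MvPolynomial.rename (coordMap e.symm) q, fun x => ?_⟩,
    fun t x => ?_⟩
  · rw [hcoord, Function.comp_apply, hPu]
  · rw [MvPolynomial.eval_rename, hcoord, Function.comp_assoc,
      show coordMap e ∘ coordMap e.symm = id from funext fun c => by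
        rcases c with ⟨i, j⟩ | ⟨⟩ <;> simp [coordMap], Function.comp_id, hq]
  · have h1 := hconj (subgroupReindex e T t) x
    rw [charReindex_apply] at h1
    have h2 := congrArg (fun g : ↥(G.map (reindexGL e).toMonoidHom) => (reindexGL e).symm (g : GL m' k)) h1
    simp only [Subgroup.coe_mul, Subgroup.coe_inv, map_mul, map_inv, Subgroup.coe_inclusion] at h2
    have h3 : (reindexGL e).symm ((subgroupReindex e T t : ↥(T.map _)) : GL m' k) = (t : GL m k) :=
      (reindexGL e).symm_apply_apply _
    rw [h3] at h2
    apply Subtype.ext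
    exact h2

/-- Roots of `(e · G, e · T)` come from roots of `(G, T)`. [folklore] -/
theorem mem_roots_of_charLatticeReindex_mem {α : ↥(characterLattice T)}
    (hα : Additive.toMul (charLatticeReindex e T (Additive.ofMul α)) ∈
      roots (G.map (reindexGL e).toMonoidHom) (T.map (reindexGL e).toMonoidHom)) :
    α ∈ roots G T := by
  obtain ⟨hne, hTG', u', hu'⟩ := hα
  have hTG : T ≤ G := (map_reindexGL_le_iff e).1 hTG'
  refine ⟨fun h1 => hne ?_, hTG, _, IsRootHom.of_reindex e hTG hu'⟩
  rw [coe_toMul_charLatticeReindex, toMul_ofMul, h1]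
  ext t
  rfl

/-- Algebraic `SL₂`-homomorphisms transport. [folklore] -/
theorem isAlgebraicSL2Hom_reindex {φ : SL(2, k) →* ↥G} (hφ : IsAlgebraicSL2Hom φ) :
    IsAlgebraicSL2Hom ((subgroupReindex e G).toMonoidHom.comp φ) := by
  obtain ⟨P, hP⟩ := hφ
  refine ⟨fun c => P (coordMap e.symm c), fun g c => ?_⟩
  rw [← hP g]
  change glCoordFun (reindexGL e ((φ g : ↥G) : GL m k)) c = _
  rw [glCoordFun_reindexGL_eq]
  rfl

end RootHoms

/-! ### Root data -/

section RootDatum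

variable (e : m ≃ m') {G T : Subgroup (GL m k)} [IsMulCommutative ↥T]
variable {ι X Y : Type*} [AddCommGroup X] [AddCommGroup Y] {P : RootPairing ι ℤ X Y}
  {eX : Additive ↥(characterLattice T) ≃+ X} {eY : Additive ↥(cocharacterLattice T) ≃+ Y}

/-- The transported identifications. [folklore] -/
abbrev eXReindex (eX : Additive ↥(characterLattice T) ≃+ X) :
    Additive ↥(characterLattice (T.map (reindexGL e).toMonoidHom)) ≃+ X :=
  (charLatticeReindex e T).symm.trans eX

/-- The transported identifications. [folklore] -/
abbrev eYReindex (eY : Additive ↥(cocharacterLattice T) ≃+ Y) :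
    Additive ↥(cocharacterLattice (T.map (reindexGL e).toMonoidHom)) ≃+ Y :=
  (cocharLatticeReindex e T).symm.trans eY

omit [IsMulCommutative ↥T] in
/-- `charOfWeight` for the transported identification. [folklore] -/
lemma charOfWeight_eXReindex (x : X) :
    charOfWeight (eXReindex e eX) x = charReindex e T (charOfWeight eX x) := by
  rw [charOfWeight, charOfWeight, AddEquiv.symm_trans_apply, AddEquiv.symm_symm]
  rfl

/-- `cocharOfCoweight` for the transported identification. [folklore] -/
lemma cocharOfCoweight_eYReindex (y : Y) :
    cocharOfCoweight (eYReindex e eY) y = cocharReindex e T (cocharOfCoweight eY y) := by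
  rw [cocharOfCoweight, cocharOfCoweight, AddEquiv.symm_trans_apply, AddEquiv.symm_symm]
  rfl

/-- **`IsRootDatumOf` transports along reindexing.** [folklore] -/
theorem IsRootDatumOf.map_reindexGL (h : IsRootDatumOf G T P eX eY) :
    IsRootDatumOf (G.map (reindexGL e).toMonoidHom) (T.map (reindexGL e).toMonoidHom) P
      (eXReindex e eX) (eYReindex e eY) where
  le := (map_reindexGL_le_iff e).2 h.le
  pairing_eq χ' γ' := by
    set χ := (charLatticeReindex e T).symm (Additive.ofMul χ') with hχ
    set γ := (cocharLatticeReindex e T).symm (Additive.ofMul γ') with hγ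
    have hχ' : (χ' : _ →* kˣ) = charReindex e T (Additive.toMul χ).1 := by
      rw [← coe_toMul_charLatticeReindex, hχ, AddEquiv.apply_symm_apply, toMul_ofMul]
    have hγ' : (γ' : kˣ →* _) = cocharReindex e T (Additive.toMul γ).1 := by
      rw [← coe_toMul_cocharLatticeReindex, hγ, AddEquiv.apply_symm_apply, toMul_ofMul]
    change P.toLinearMap (eX χ) (eY γ) = _
    rw [hχ', hγ', charPairingInt_reindex]
    exact h.pairing_eq (Additive.toMul χ) (Additive.toMul γ)
  range_root := by
    rw [h.range_root]
    ext x
    constructor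
    · rintro ⟨α, hα, rfl⟩
      refine ⟨charLatticeReindex e T α, charLatticeReindex_mem_roots e hα, ?_⟩
      change eX ((charLatticeReindex e T).symm (charLatticeReindex e T α)) = eX α
      rw [AddEquiv.symm_apply_apply]
    · rintro ⟨α', hα', rfl⟩
      refine ⟨(charLatticeReindex e T).symm α', mem_roots_of_charLatticeReindex_mem e ?_, rfl⟩
      change Additive.toMul (charLatticeReindex e T ((charLatticeReindex e T).symm α')) ∈ _
      rw [AddEquiv.apply_symm_apply]
      exact hα'
  exists_sl2Hom i := by
    obtain ⟨φ, hφ, hu, hl, hd⟩ := h.exists_sl2Hom i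
    refine ⟨(subgroupReindex e G).toMonoidHom.comp φ, isAlgebraicSL2Hom_reindex e hφ, ?_, ?_, fun t => ?_⟩
    · rw [charOfWeight_eXReindex, MonoidHom.comp_assoc]
      exact hu.reindex e h.le
    · rw [charOfWeight_eXReindex, show (charReindex e T (charOfWeight eX (P.root i)))⁻¹ =
        charReindex e T (charOfWeight eX (P.root i))⁻¹ by rfl, MonoidHom.comp_assoc]
      exact hl.reindex e h.le
    · rw [cocharOfCoweight_eYReindex, MonoidHom.comp_apply, hd t]
      rfl

end RootDatum


/-! ### Packaging: realisations in `GL (Fin N) k` -/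

/-- **A realisation of a root datum by `(G, T)` in `GL m k` gives one in `GL (Fin (card m)) k`**
(reindex along `Fintype.equivFin m`). [folklore] -/
theorem exists_fin_of_isRootDatumOf {G T : Subgroup (GL m k)} [IsMulCommutative ↥T]
    {ι X Y : Type*} [AddCommGroup X] [AddCommGroup Y] {P : RootPairing ι ℤ X Y}
    {eX : Additive ↥(characterLattice T) ≃+ X} {eY : Additive ↥(cocharacterLattice T) ≃+ Y}
    (hG : IsConnectedReductive G) (hT : IsMaximalTorusIn T G) (h : IsRootDatumOf G T P eX eY) :
    ∃ (G' T' : Subgroup (GL (Fin (Fintype.card m)) k)) (_ : IsMulCommutative ↥T')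
      (eX' : Additive ↥(characterLattice T') ≃+ X) (eY' : Additive ↥(cocharacterLattice T') ≃+ Y),
      IsConnectedReductive G' ∧ IsMaximalTorusIn T' G' ∧ IsRootDatumOf G' T' P eX' eY' :=
  ⟨_, _, inferInstance, _, _, isConnectedReductive_map_reindexGL (Fintype.equivFin m) hG,
    isMaximalTorusIn_map_reindexGL (Fintype.equivFin m) hT, h.map_reindexGL (Fintype.equivFin m)⟩

end Literature.NumberTheory.Automorphic
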